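import Mathlib
import Summits.ValiantsHypothesis.ValiantsHypothesis.Theorems.BarrierLeverPartitionMinorsHitByVPHiddenStatesSymbolic

/-!
# Route BarrierLever — item `PartitionMinorsHitByVP` (stmt-ValiantsHypothesis-19717), line `hidden-states`:
# FREE COMPLETION — star points complete ANY configuration whose structured columns are linearly independent

Helper file (`--supports stmt-ValiantsHypothesis-19717`; cell valiant-natproofs, rung V4, 𝒟-side door (c), registered line
`Cruxes/PartitionMinorsHitByVP/Lines/hidden_states.lean` v7; prover seat val-np-p6 gen 12). Definition-free; closes NO item.

THE POINT. The «tiled core + free points» theorem of the line (`SymbJoin.symGood_core_free`, p602295) absorbs the non-core rows by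
the ADD-ROW cut, which needs every non-core row to lie inside no core row. For cores that are NOT tilings (the tilted cubes of the
flag conjecture, memo val-np-p6 g11 §5) that order condition is unavailable. Here is the order-free, genuinely generic statement:
let the columns of a design `e` split into STRUCTURED columns (pieces in a set `Pc`) and STAR columns (pieces outside `Pc`, state sets
of cardinality `≤ 1`). If for SOME table `tx₀` the structured columns of the block-additive matrix against an injective row family `u`
are linearly independent, then some table makes the whole matrix nonsingular (`exists_table_of_indepCore`; symbolic form
`symGood_of_indepCore`). Proof: keep `tx₀` on the structured pieces; a star piece `p` with base point `c(s₀)` and state vectors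
`c(s_q) − c(s₀)`, `c(s) = (s^{2^a})_a` the binary moment curve of `…TwoLayerWitness` (p577133), has hidden points `c(s₀)`, `c(s_q)` —
independent curve points, one parameter per column; the curve leaves every proper subspace (`TwoLayer.exists_curveVec_not_mem`), so
the star columns can be added one at a time keeping the columns independent.

WHAT THIS IS NOT: a tool; no family is certified here; nothing on crux 14610 or VP ≠ VNP.
-/

set_option linter.dupNamespace false

namespace Summit.ValiantsHypothesis.ValiantsHypothesis.Theorems.BarrierLever.HiddenStates

open Finset Matrix MvPolynomial

noncomputable section

namespace SymbJoin

variable {h m K r : ℕ}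

/-- **FREE COMPLETION (numeric form).** `u` injective rows, `e` an injective design, `Pc` a set of pieces; every column outside `Pc`
is a star column (state set of cardinality `≤ 1`). If for some table `tx₀` the columns in `Pc` of the block-additive matrix are
linearly independent (stated as: a vanishing combination supported on them is zero), then some table makes the matrix nonsingular. -/
theorem exists_table_of_indepCore (u : Fin r → Finset (Fin h)) (hu : Function.Injective u)
    (e : Fin r → Fin m × Finset (Fin K)) (he : Function.Injective e) (Pc : Finset (Fin m))
    (hstar : ∀ k, (e k).1 ∉ Pc → ((e k).2).card ≤ 1)
    (tx₀ : Fin m → Option (Fin K) → Fin h → ℂ)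
    (hind : ∀ α : Fin r → ℂ, (∀ k, (e k).1 ∉ Pc → α k = 0) →
      (∑ k, α k • (fun i => ∏ a ∈ u i, (tx₀ (e k).1 none a + ∑ q ∈ (e k).2, tx₀ (e k).1 (some q) a))) = 0 →
      ∀ k, α k = 0) :
    ∃ tx : Fin m → Option (Fin K) → Fin h → ℂ,
      (Matrix.of fun i k : Fin r =>
        ∏ a ∈ u i, (tx (e k).1 none a + ∑ q ∈ (e k).2, tx (e k).1 (some q) a)).det ≠ 0 := by
  classical
  -- the table as a function of the curve parameters `τ p o`
  let T : (Fin m → Option (Fin K) → ℂ) → Fin m → Option (Fin K) → Fin h → ℂ := fun τ p o a =>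
    if p ∈ Pc then tx₀ p o a else
      match o with
      | none => τ p none ^ (2 ^ (a : ℕ))
      | some q => τ p (some q) ^ (2 ^ (a : ℕ)) - τ p none ^ (2 ^ (a : ℕ))
  let col : (Fin m → Option (Fin K) → ℂ) → Fin r → (Fin r → ℂ) := fun τ k i =>
    ∏ a ∈ u i, (T τ (e k).1 none a + ∑ q ∈ (e k).2, T τ (e k).1 (some q) a)
  -- the parameter slot of a star column
  let slot : Fin r → Option (Fin K) := fun k => if hk : ((e k).2).Nonempty then some (hk.choose) else none
  let core : Finset (Fin r) := Finset.univ.filter fun k => (e k).1 ∈ Pc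
  have hcorecol : ∀ τ, ∀ k ∈ core, col τ k = fun i => ∏ a ∈ u i, (tx₀ (e k).1 none a + ∑ q ∈ (e k).2, tx₀ (e k).1 (some q) a) := by
    intro τ k hk
    have hk' : (e k).1 ∈ Pc := (Finset.mem_filter.mp hk).2
    funext i
    simp only [col, T, if_pos hk']
  have hslot : ∀ k, k ∉ core → (e k).2 = ∅ ∧ slot k = none ∨ ∃ q, (e k).2 = {q} ∧ slot k = some q := by
    intro k hk
    have hk' : (e k).1 ∉ Pc := fun h' => hk (Finset.mem_filter.mpr ⟨Finset.mem_univ _, h'⟩)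
    have hcard := hstar k hk'
    by_cases hne : ((e k).2).Nonempty
    · right
      obtain ⟨q, hq⟩ := Finset.card_eq_one.mp (le_antisymm hcard (Finset.card_pos.mpr hne))
      have hch : hne.choose = q := Finset.mem_singleton.mp (by rw [← hq]; exact hne.choose_spec)
      exact ⟨q, hq, by simp only [slot, dif_pos hne, hch]⟩
    · left
      exact ⟨Finset.not_nonempty_iff_eq_empty.mp hne, by simp only [slot, dif_neg hne]⟩
  have hfreecol : ∀ τ k, k ∉ core → col τ k = TwoLayer.curveVec u (τ (e k).1 (slot k)) := by
    intro τ k hk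
    have hk' : (e k).1 ∉ Pc := fun h' => hk (Finset.mem_filter.mpr ⟨Finset.mem_univ _, h'⟩)
    funext i
    rcases hslot k hk with ⟨h0, hs⟩ | ⟨q, hq, hs⟩
    · simp only [col, T, if_neg hk', h0, hs, Finset.sum_empty, add_zero, TwoLayer.curveVec, Finset.prod_pow_eq_pow_sum]
    · simp only [col, T, if_neg hk', hq, hs, Finset.sum_singleton, add_sub_cancel, TwoLayer.curveVec, Finset.prod_pow_eq_pow_sum]
  -- distinct star columns have distinct parameter slots
  have hslot_inj : ∀ k k', k ∉ core → k' ∉ core → (e k).1 = (e k').1 → slot k = slot k' → k = k' := by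
    intro k k' hk hk' hp hs
    apply he
    refine Prod.ext hp ?_
    rcases hslot k hk with ⟨h0, hs0⟩ | ⟨q, hq, hs0⟩ <;> rcases hslot k' hk' with ⟨h0', hs0'⟩ | ⟨q', hq', hs0'⟩
    · rw [h0, h0']
    · rw [hs0, hs0'] at hs; exact absurd hs (by simp)
    · rw [hs0, hs0'] at hs; exact absurd hs (by simp)
    · rw [hs0, hs0'] at hs; rw [hq, hq', Option.some_injective _ hs]
  -- independence of the columns supported on `A`, for parameters `τ`
  obtain ⟨Indep, hIndep⟩ : ∃ Indep : (Fin m → Option (Fin K) → ℂ) → Finset (Fin r) → Prop, ∀ τ A, Indep τ A ↔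
      ∀ α : Fin r → ℂ, (∀ k, k ∉ A → α k = 0) → ∑ k, α k • col τ k = 0 → ∀ k, α k = 0 := ⟨_, fun _ _ => Iff.rfl⟩
  have hbase : ∀ τ, Indep τ core := by
    intro τ
    rw [hIndep]
    intro α hαA hsum
    refine hind α (fun k hk => hαA k fun h' => hk (Finset.mem_filter.mp h').2) ?_
    rw [← hsum]
    refine Finset.sum_congr rfl fun k _ => ?_
    by_cases hk : k ∈ core
    · rw [hcorecol τ k hk]
    · rw [hαA k hk, zero_smul, zero_smul]
  -- induction step: add one star column
  have hstep : ∀ (A : Finset (Fin r)), core ⊆ A → (∃ τ, Indep τ A) → ∀ k₁, k₁ ∉ A → ∃ τ, Indep τ (insert k₁ A) := by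
    intro A hcA ⟨τ, hτ⟩ k₁ hk₁
    rw [hIndep] at hτ
    have hk₁core : k₁ ∉ core := fun h' => hk₁ (hcA h')
    set W : Submodule ℂ (Fin r → ℂ) := Submodule.span ℂ (Set.range fun k : A => col τ k) with hW
    have hWlt : W < ⊤ := by
      have h1 : Module.finrank ℂ W ≤ Fintype.card A := finrank_range_le_card _
      have h2 : Fintype.card A < Fintype.card (Fin r) := by
        rw [Fintype.card_coe]
        exact Finset.card_lt_card (Finset.ssubset_iff_subset_ne.mpr ⟨Finset.subset_univ A,
          fun h' => hk₁ (h' ▸ Finset.mem_univ k₁)⟩)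
      have h3 : Module.finrank ℂ (Fin r → ℂ) = Fintype.card (Fin r) := Module.finrank_fintype_fun_eq_card ℂ
      exact Submodule.lt_top_of_finrank_lt_finrank (by omega)
    obtain ⟨s, hs⟩ := TwoLayer.exists_curveVec_not_mem u hu W hWlt
    -- new parameters: `τ` updated at the slot of `k₁`
    let τ' : Fin m → Option (Fin K) → ℂ := fun p o => if p = (e k₁).1 ∧ o = slot k₁ then s else τ p o
    have hsame : ∀ k ∈ A, col τ' k = col τ k := by
      intro k hk
      by_cases hkc : k ∈ core
      · rw [hcorecol τ' k hkc, hcorecol τ k hkc]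
      · rw [hfreecol τ' k hkc, hfreecol τ k hkc]
        have hne : k ≠ k₁ := fun h' => hk₁ (h' ▸ hk)
        have hcond : ¬ ((e k).1 = (e k₁).1 ∧ slot k = slot k₁) := fun h' => hne (hslot_inj k k₁ hkc hk₁core h'.1 h'.2)
        simp only [τ', if_neg hcond]
    have hnew : col τ' k₁ = TwoLayer.curveVec u s := by
      rw [hfreecol τ' k₁ hk₁core]
      simp only [τ', if_pos (And.intro rfl rfl)]
    refine ⟨τ', ?_⟩
    rw [hIndep]
    intro α hαA hsum
    have hαk₁ : α k₁ = 0 := by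
      by_contra hne
      apply hs
      have hexpr : TwoLayer.curveVec u s = -(α k₁)⁻¹ • ∑ k ∈ A, α k • col τ k := by
        have hsplit : ∑ k, α k • col τ' k = α k₁ • col τ' k₁ + ∑ k ∈ A, α k • col τ' k := by
          rw [← Finset.sum_subset (Finset.subset_univ (insert k₁ A))
            (fun k _ hk => by rw [hαA k hk, zero_smul]), Finset.sum_insert hk₁]
        rw [hsplit, hnew] at hsum
        have hA : ∑ k ∈ A, α k • col τ' k = ∑ k ∈ A, α k • col τ k :=
          Finset.sum_congr rfl fun k hk => by rw [hsame k hk]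
        rw [hA] at hsum
        have : α k₁ • TwoLayer.curveVec u s = -∑ k ∈ A, α k • col τ k := eq_neg_of_add_eq_zero_left hsum
        calc TwoLayer.curveVec u s = (α k₁)⁻¹ • (α k₁ • TwoLayer.curveVec u s) := by
              rw [smul_smul, inv_mul_cancel₀ hne, one_smul]
          _ = -(α k₁)⁻¹ • ∑ k ∈ A, α k • col τ k := by rw [this, smul_neg, neg_smul]
      rw [hexpr]
      refine Submodule.smul_mem _ _ (Submodule.sum_mem _ fun k hk => Submodule.smul_mem _ _ ?_)
      exact Submodule.subset_span ⟨⟨k, hk⟩, rfl⟩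
    have hαT : ∀ k, k ∉ A → α k = 0 := by
      intro k hk
      by_cases hkk : k = k₁
      · rw [hkk]; exact hαk₁
      · exact hαA k (fun h' => by rcases Finset.mem_insert.mp h' with h'' | h''; exact hkk h''; exact hk h'')
    have hsum' : ∑ k, α k • col τ k = 0 := by
      rw [← hsum]
      refine Finset.sum_congr rfl fun k _ => ?_
      by_cases hkT : k ∈ A
      · rw [hsame k hkT]
      · rw [hαT k hkT, zero_smul, zero_smul]
    exact hτ α hαT hsum'
  -- all columns independent for some parameters
  have hall : ∃ τ, Indep τ Finset.univ := by
    have H : ∀ D : Finset (Fin r), ∃ τ, Indep τ (core ∪ D) := by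
      intro D
      induction D using Finset.induction_on with
      | empty => refine ⟨fun _ _ => 0, ?_⟩; rw [Finset.union_empty]; exact hbase _
      | @insert k D hkD ih =>
        by_cases hk : k ∈ core ∪ D
        · have : core ∪ insert k D = core ∪ D := by
            rw [Finset.union_insert, Finset.insert_eq_of_mem hk]
          rw [this]; exact ih
        · have := hstep (core ∪ D) Finset.subset_union_left ih k hk
          rwa [← Finset.union_insert] at this
    have := H Finset.univ
    have hu' : core ∪ Finset.univ = Finset.univ := by ext; simp
    rwa [hu'] at this
  obtain ⟨τ, hτ⟩ := hall
  rw [hIndep] at hτ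
  refine ⟨T τ, ?_⟩
  intro hdet
  obtain ⟨α, hαne, hαmul⟩ := Matrix.exists_mulVec_eq_zero_iff.mpr hdet
  apply hαne
  funext k
  refine hτ α (fun k hk => absurd (Finset.mem_univ k) hk) ?_ k
  funext i
  have := congrFun hαmul i
  rw [Matrix.mulVec, dotProduct] at this
  simp only [Matrix.of_apply, Pi.zero_apply] at this
  rw [Finset.sum_apply, Pi.zero_apply]
  simpa [col, Pi.smul_apply, smul_eq_mul, mul_comm] using this

/-- **FREE COMPLETION (symbolic form).** Under the hypotheses of `exists_table_of_indepCore`, `(u, e)` is generically good. -/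
theorem symGood_of_indepCore (u : Fin r → Finset (Fin h)) (hu : Function.Injective u)
    (e : Fin r → Fin m × Finset (Fin K)) (he : Function.Injective e) (Pc : Finset (Fin m))
    (hstar : ∀ k, (e k).1 ∉ Pc → ((e k).2).card ≤ 1)
    (tx₀ : Fin m → Option (Fin K) → Fin h → ℂ)
    (hind : ∀ α : Fin r → ℂ, (∀ k, (e k).1 ∉ Pc → α k = 0) →
      (∑ k, α k • (fun i => ∏ a ∈ u i, (tx₀ (e k).1 none a + ∑ q ∈ (e k).2, tx₀ (e k).1 (some q) a))) = 0 →
      ∀ k, α k = 0) :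
    symDet u e ≠ 0 := by
  obtain ⟨tx, htx⟩ := exists_table_of_indepCore u hu e he Pc hstar tx₀ hind
  exact symGood_of_table u e tx htx

end SymbJoin

end

end Summit.ValiantsHypothesis.ValiantsHypothesis.Theorems.BarrierLever.HiddenStates
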